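import Literature.MathematicalPhysics.QuantumLattice.HubbardFermiLiquid
import Literature.MathematicalPhysics.QuantumLattice.FermionQuasiFree
import Literature.Analysis.Complex.BoundedAnalyticFamilyLimit
import HarnessLib

/-!
# The thermodynamic limit of `bgm_two_point_limit` from a volume-uniform radius of analyticity
(Vitali's theorem): the assembly step of Benfatto–Giuliani–Mastropietro's proof

Sibling file of `HubbardFermiLiquid.lean` (named fact `bgm_two_point_limit`, BGM 2006 Thm. 1.1:
convergence of `hubbardThermalTwoPoint β U μ L x y σ σ'` as `L → ∞` in the regime `|U| ≤ U₀`,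
`β ≤ e^{c/|U|}`). At finite volume the two-point function is a ratio of traces of
`e^{-β(H₀ + U V)}`, hence the restriction to real `U` of a meromorphic function of a COMPLEX
coupling (`hubbardThermalTwoPointC`, `hubbardThermalTwoPointC_ofReal`; `H₀ = dΓ(h_L)`,
`V = Σ_x n_{x↑}n_{x↓}`). BGM's multiscale analysis delivers, at fixed `β`, bounds on the resummed
expansion that are uniform in the volume (§2.2 footnote 1; Remark after Thm. 2.1), i.e. a radius of
analyticity in `U` and a bound uniform in `L`; the passage to `L = ∞` is then the classical
Vitali/Montel argument (the tree's `Literature.Analysis.Complex.tendsto_of_forall_tendsto_taylorCoeff`: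
a uniformly bounded analytic family whose Taylor coefficients converge, converges). This file
PROVES that assembly:

* `tendsto_hubbardThermalTwoPoint_of_uniform_analyticity` — if for `L ≥ L₀` the complex-coupling
  two-point functions are analytic on the closed disc `|U| ≤ R` (partition function non-vanishing
  there), bounded by `M` on the circle `|U| = R`, and each normalised Taylor coefficient at `U = 0`
  converges as `L → ∞` (order-by-order thermodynamic limit of perturbation theory), then for every
  REAL `|U| < R` the thermal two-point function converges as `L → ∞`;
* `bgm_two_point_limit_of_uniform_analyticity` — hence `bgm_two_point_limit` follows from these
  two inputs supplied, for each `μ` in the range and each `β`, with a radius `R(β)` exceeding every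
  real coupling admissible at that temperature (`0 < |U| ≤ U₀`, `β ≤ e^{c/|U|}`, i.e.
  `|U| ≤ min(U₀, c/log β)` — BGM's smallness condition `U₀|h_β| ≤ c₀`).

No new named fact: the two inputs are HYPOTHESES of proved theorems (the first is the content of
BGM's renormalization group, §2–§3; the second is the order-by-order thermodynamic limit, §2.2
footnote 1 / [BM2001]).

## References

* G. Benfatto, A. Giuliani, V. Mastropietro, Ann. Henri Poincaré 7 (2006) 809–898, Thm. 1.1,
  §2.2 footnote 1, Remark after Thm. 2.1 (arXiv:cond-mat/0507686 pp. 3, 8, 15).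
  [BenfattoGiulianiMastropietro2006]
* Vitali's convergence theorem in the elementary form of
  `Literature/Analysis/Complex/BoundedAnalyticFamilyLimit.lean` (Cauchy estimates + Tannery).
-/

noncomputable section

open Filter Metric Complex
open scoped Topology Nat
open Literature.Probability.LatticeModels

namespace Literature.MathematicalPhysics.QuantumLattice

/-! ### The two-point function at complex coupling -/

/-- The on-site interaction `V = Σ_x n_{x↑} n_{x↓}` of the Hubbard torus. [cite: BenfattoGiulianiMastropietro2006, eq. (1.1)] -/
def hubbardTorusInteraction (L : ℕ) [NeZero L] :
    Matrix (Finset (Orb (FermionTorus 2 L))) (Finset (Orb (FermionTorus 2 L))) ℂ :=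
  ∑ x : FermionTorus 2 L, creation (orb x 0) * annihilation (orb x 0) * (creation (orb x 1) * annihilation (orb x 1))

/-- `H_L(1, U) - μN = dΓ(h_L) + U · V` (the affine dependence on the coupling). [folklore] -/
theorem hubbardTorusWith_eq_dGamma_add_smul (L : ℕ) [NeZero L] (U μ : ℝ) :
    hubbardTorusWith 2 L 1 U μ =
      dGamma (hubbardOneBody (fermionTorusGraph 2 L) 1 μ) + (U : ℂ) • hubbardTorusInteraction L := by
  rw [← hamiltonianWith_zero_eq_dGamma]
  change hamiltonianWith (fermionTorusGraph 2 L) 1 U μ = hamiltonianWith (fermionTorusGraph 2 L) 1 0 μ + _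
  simp only [hamiltonianWith, hamiltonian, Complex.ofReal_zero, zero_smul, add_zero, numberOp,
    hubbardTorusInteraction]
  abel

/-- **The finite-volume two-point function at COMPLEX coupling**:
`⟨c†_{xσ} c_{yσ'}⟩_{β,L,U} = Tr(e^{-β(dΓ(h_L) + U V)} c†c) / Tr e^{-β(dΓ(h_L) + U V)}`, `U ∈ ℂ`
(junk `0` for `L = 0`; a ratio of entire functions of `U`). [cite: BenfattoGiulianiMastropietro2006, §1] -/
def hubbardThermalTwoPointC (β : ℝ) (U : ℂ) (μ : ℝ) (L : ℕ) (x y : Site 2) (σ σ' : Fin 2) : ℂ :=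
  if hL : L = 0 then 0
  else
    haveI : NeZero L := ⟨hL⟩
    Matrix.thermalCorr β
      (dGamma (hubbardOneBody (fermionTorusGraph 2 L) 1 μ) + U • hubbardTorusInteraction L)
      (creation (orb (FermionTorus.ofTorusSite (Torus.proj L x)) σ))
      (annihilation (orb (FermionTorus.ofTorusSite (Torus.proj L y)) σ'))

/-- At real coupling the complex-coupling two-point function is the fact's `hubbardThermalTwoPoint`. [folklore] -/
theorem hubbardThermalTwoPointC_ofReal (β U μ : ℝ) (L : ℕ) (x y : Site 2) (σ σ' : Fin 2) :
    hubbardThermalTwoPointC β (U : ℂ) μ L x y σ σ' = hubbardThermalTwoPoint β U μ L x y σ σ' := by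
  unfold hubbardThermalTwoPointC hubbardThermalTwoPoint
  split_ifs with hL
  · rfl
  · haveI : NeZero L := ⟨hL⟩
    rw [hubbardTorusWith_eq_dGamma_add_smul]

/-! ### Vitali: convergence from a volume-uniform radius of analyticity -/

/-- **The thermodynamic limit from a uniform radius of analyticity and the order-by-order limit**
(Vitali's theorem, BGM's assembly step): fix `β, μ, x, y, σ, σ'` and write
`F_L(U) = hubbardThermalTwoPointC β U μ L x y σ σ'`. Suppose that for some `R > 0`, `M` and `L₀`:
(i) for `L ≥ L₀`, `F_L` is complex differentiable on the open disc `|U| < R` and continuous on its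
closure; (ii) `|F_L(U)| ≤ M` on the circle `|U| = R` for `L ≥ L₀`; (iii) for every `n` the
normalised Taylor coefficient `(n!)⁻¹ F_L^{(n)}(0)` converges as `L → ∞`. Then for every real `U`
with `|U| < R` the finite-volume two-point functions `⟨c†_{xσ} c_{yσ'}⟩_{β,L,U}` converge as
`L → ∞`. [cite: BenfattoGiulianiMastropietro2006, Thm. 1.1 ("in the limit L = ∞")] -/
theorem tendsto_hubbardThermalTwoPoint_of_uniform_analyticity (β μ : ℝ) (x y : Site 2) (σ σ' : Fin 2)
    {R M : ℝ} (hR : 0 < R) {L₀ : ℕ}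
    (hd : ∀ L, L₀ ≤ L → DiffContOnCl ℂ (fun U : ℂ => hubbardThermalTwoPointC β U μ L x y σ σ') (ball 0 R))
    (hM : ∀ L, L₀ ≤ L → ∀ z ∈ sphere (0 : ℂ) R, ‖hubbardThermalTwoPointC β z μ L x y σ σ'‖ ≤ M)
    (ha : ∀ n : ℕ, ∃ a : ℂ, Tendsto
      (fun L : ℕ => (n ! : ℂ)⁻¹ • iteratedDeriv n (fun U : ℂ => hubbardThermalTwoPointC β U μ L x y σ σ') 0)
      atTop (𝓝 a))
    {U : ℝ} (hU : |U| < R) :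
    ∃ S : ℂ, Tendsto (fun L : ℕ => hubbardThermalTwoPoint β U μ L x y σ σ') atTop (𝓝 S) := by
  choose a ha using ha
  -- shift the volume index by `L₀` so that (i)–(ii) hold for all indices
  set F : ℕ → ℂ → ℂ := fun k U => hubbardThermalTwoPointC β U μ (k + L₀) x y σ σ' with hF
  have hd' : ∀ k, DiffContOnCl ℂ (F k) (ball 0 R) := fun k => hd (k + L₀) (Nat.le_add_left _ _)
  have hM' : ∀ k, ∀ z ∈ sphere (0 : ℂ) R, ‖F k z‖ ≤ M := fun k => hM (k + L₀) (Nat.le_add_left _ _)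
  have ha' : ∀ n, Tendsto (fun k : ℕ => (n ! : ℂ)⁻¹ • iteratedDeriv n (F k) 0) atTop (𝓝 (a n)) :=
    fun n => (ha n).comp (tendsto_add_atTop_nat L₀)
  have hz : ‖((U : ℝ) : ℂ)‖ < R := by rwa [Complex.norm_real, Real.norm_eq_abs]
  have hlim := Literature.Analysis.Complex.tendsto_of_forall_tendsto_taylorCoeff hR hd' hM' ha' hz
  refine ⟨∑' n, ((U : ℝ) : ℂ) ^ n • a n, ?_⟩
  rw [← tendsto_add_atTop_iff_nat L₀]
  simpa only [hF, hubbardThermalTwoPointC_ofReal] using hlim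

/-- **`bgm_two_point_limit` from BGM's two inputs.** Suppose that for every `μ` in the range there
are `U₀, c > 0` such that for every `β > 0` and all `x, y, σ, σ'` the complex-coupling two-point
functions have, for `L` large, a common disc of analyticity `|U| < R(β)` whose radius exceeds every
ADMISSIBLE real coupling of the window at that temperature (`0 < |U| ≤ U₀`, `β ≤ e^{c/|U|}`, i.e.
`|U| ≤ min(U₀, c/log β)`: BGM's `U₀|h_β| ≤ c₀`), a common bound on the circle `|U| = R(β)`, and
convergent normalised Taylor coefficients at `U = 0`. Then `bgm_two_point_limit` holds. (The first
input is the renormalization-group content of BGM §2–§3 at fixed `β`; the second the order-by-order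
thermodynamic limit of perturbation theory.) [cite: BenfattoGiulianiMastropietro2006, Thm. 1.1] -/
theorem bgm_two_point_limit_of_uniform_analyticity
    (h : ∀ μ : ℝ, -4 < μ → μ < -2 - Real.sqrt 2 → ∃ U₀ c : ℝ, 0 < U₀ ∧ 0 < c ∧
      ∀ β : ℝ, 0 < β → ∀ (x y : Site 2) (σ σ' : Fin 2), ∃ (R M : ℝ) (L₀ : ℕ), 0 < R ∧
        (∀ U : ℝ, U ≠ 0 → |U| ≤ U₀ → β ≤ Real.exp (c / |U|) → |U| < R) ∧
        (∀ L, L₀ ≤ L → DiffContOnCl ℂ (fun U : ℂ => hubbardThermalTwoPointC β U μ L x y σ σ') (ball 0 R)) ∧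
        (∀ L, L₀ ≤ L → ∀ z ∈ sphere (0 : ℂ) R, ‖hubbardThermalTwoPointC β z μ L x y σ σ'‖ ≤ M) ∧
        (∀ n : ℕ, ∃ a : ℂ, Tendsto
          (fun L : ℕ => (n ! : ℂ)⁻¹ • iteratedDeriv n (fun U : ℂ => hubbardThermalTwoPointC β U μ L x y σ σ') 0)
          atTop (𝓝 a))) :
    bgm_two_point_limit := by
  intro μ hμ₁ hμ₂
  obtain ⟨U₀, c, hU₀, hc, hβ⟩ := h μ hμ₁ hμ₂
  refine ⟨U₀, c, hU₀, hc, fun U β hU0 hUU₀ hβ0 hβU x y σ σ' => ?_⟩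
  obtain ⟨R, M, L₀, hR, hwin, hd, hM, ha⟩ := hβ β hβ0 x y σ σ'
  exact tendsto_hubbardThermalTwoPoint_of_uniform_analyticity β μ x y σ σ' hR hd hM ha
    (hwin U hU0 hUU₀ hβU)

end Literature.MathematicalPhysics.QuantumLattice

end
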